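import Mathlib
import Summits.NavierStokesRegularity.NavierStokesRegularity.Theorems.EulerZoomLiouvillePowerGaugeEulerLiouvilleFarFieldTools
import Summits.NavierStokesRegularity.NavierStokesRegularity.Theorems.EulerZoomLiouvillePowerGaugeEulerLiouvilleTwoSphereLaw
import Summits.NavierStokesRegularity.NavierStokesRegularity.Theorems.EulerZoomLiouvillePowerGaugeEulerLiouvilleTransportBallLaw

/-!
# R49 plate 2.9 (t52-FF): the FAR-FIELD SPHERE-MEAN LAW (nsreg-p2 ROUND-49 «EVERY BALL BREATHES», `NsregP2.R49.FarFieldSphereMean γ ρ`,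
# text VERBATIM from `r49/Sketch49.lean` (v1.2, binders `0 < ρ → ρ < 1 →`); seat ns-ezl-w2 g6, `--supports stmt-NavierStokesRegularity-19832 --as helper`)

For a `γ`-profile `(V, P)` centred at the origin carrying the self-similar (A)-budget `L^{2ρ−1}∫_{B_L}‖V‖² ≤ C` (`L ≥ 1`) and the (D)-budget
`∫|P|^{3/2}‖y‖^{2ρ−2} < ∞`, for EVERY `r > 0` and the `r`-derivative `S` of `ϱ ↦ ∫_{B_ϱ}(V_n² + P)`:
`S/(4πr²) = (1/4π) ∫_{‖y‖ ≥ r} (3V_n² − ‖V‖²)‖y‖⁻³ dy` — far spheres are not pressurised on average (HOOP-NOTE §1 CLASS READING,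
ns-idea-11 g8; printed ancestor Chae 2012 Thm 1.2).
Proof: `S = r²·S₀(r)` (ns-sfl-p1 g8's `hasDerivAt_integral_ball_normalSq_add`, `S₀(t) = ∫_σ(⟪V(tθ),θ⟫² + P(tθ))dσ`); the two-sphere law
`S₀(r) − S₀(t) = ∫_{B_t∖B_r}(3V_n² − ‖V‖²)‖y‖⁻³` (`shellLaw` at `α = 3`); the integrand is `L¹` on `{‖y‖ ≥ r}` by the (A)-budget
(`integrableOn_twoSphereIntegrand_compl_ball`); and along the CHEAP SPHERES `t_k ∈ [2^kR₀, 2^{k+1}R₀]` (`exists_radius_sphere_le_shell`)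
`|S₀(t_k)| ≤ (2^kR₀)⁻³ ∫_{shell_k}(‖V‖² + |P|) ≤ C′(2^kR₀)^{−2−2ρ} + C″(2^kR₀)^{−(2+4ρ)/3} → 0` ((A) for `‖V‖²`, Young `3/2, 3` with
`ε_k = (2^kR₀)^{(7−4ρ)/3}` for `|P|`); `tendsto_setIntegral_of_monotone` passes to `t_k → ∞`.

HONEST FRAMING: a ROUND-49 instrument identity (class-free: the budgets are hypotheses on a hypothetical profile); nothing about the crux E
(19832 OPEN) or NS regularity. [cite: ChaeWolf2016, Remark 2.3 (2.8); Chae 2012 (arXiv:1110.3631) Thm 1.2] [folklore]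
-/

noncomputable section

set_option linter.dupNamespace false

open MeasureTheory Set Filter Topology Metric Function TopologicalSpace
open scoped ENNReal NNReal RealInnerProductSpace Topology

namespace Summit.NavierStokesRegularity.NavierStokesRegularity.Theorems.PowerGaugeEulerLiouville

open Literature.Analysis Literature.Analysis.FunctionSpaces Literature.Analysis.FluidPDE

namespace ClassicalProfile

/-- `L ↦ c·L^{−m} → 0` along `L_k = 2^k R₀` (`m > 0`, `R₀ > 0`). [folklore] -/
private theorem tendsto_const_mul_dyadic_rpow_neg {R₀ m : ℝ} (hR₀ : 0 < R₀) (hm : 0 < m) (c : ℝ) :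
    Tendsto (fun k : ℕ => c * ((2 : ℝ) ^ k * R₀) ^ (-m)) atTop (𝓝 0) := by
  have h1 : Tendsto (fun k : ℕ => (2 : ℝ) ^ k * R₀) atTop atTop :=
    (tendsto_pow_atTop_atTop_of_one_lt (by norm_num : (1 : ℝ) < 2)).atTop_mul_const hR₀
  have h2 := (tendsto_rpow_neg_atTop hm).comp h1
  simpa using h2.const_mul c

/-- **FAR-FIELD SPHERE-MEAN LAW** (`NsregP2.R49.FarFieldSphereMean γ ρ`, text verbatim): see the module docstring.
[cite: ChaeWolf2016, Remark 2.3 (2.8); Chae2012, Theorem 1.2] [folklore] -/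
theorem farFieldSphereMean (γ ρ : ℝ) :
    0 < ρ → ρ < 1 →
    ∀ (V : EuclideanSpace ℝ (Fin 3) → EuclideanSpace ℝ (Fin 3)) (P : EuclideanSpace ℝ (Fin 3) → ℝ),
      IsSelfSimilarEulerProfile γ 0 V P →
      (∃ C : ℝ, ∀ L : ℝ, 1 ≤ L → L ^ (2 * ρ - 1) * ∫ y in ball (0 : EuclideanSpace ℝ (Fin 3)) L, ‖V y‖ ^ 2 ≤ C) →
      Integrable (fun y : EuclideanSpace ℝ (Fin 3) => |P y| ^ (3 / 2 : ℝ) * ‖y‖ ^ (2 * ρ - 2)) →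
        ∀ (r S : ℝ), 0 < r →
          HasDerivAt (fun ϱ => ∫ y in ball (0 : EuclideanSpace ℝ (Fin 3)) ϱ, (⟪V y, y⟫ ^ 2 / ‖y‖ ^ 2 + P y)) S r →
            S / (4 * Real.pi * r ^ 2)
              = 1 / (4 * Real.pi) * ∫ y in (ball (0 : EuclideanSpace ℝ (Fin 3)) r)ᶜ,
                  (3 * ⟪V y, y⟫ ^ 2 / ‖y‖ ^ 2 - ‖V y‖ ^ 2) / ‖y‖ ^ 3 := by
  intro hρ0 hρ1 V P hprof hA hD r S hr hS
  obtain ⟨C, hA⟩ := hA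
  have hV : Continuous V := hprof.contDiff_velocity.continuous
  have hP : Continuous P := hprof.contDiff_pressure.continuous
  have hE : ∀ L : ℝ, 0 < L → ∫ y in ball (0 : EuclideanSpace ℝ (Fin 3)) L, ‖V y‖ ^ 2 ≤ C * (1 + L ^ (1 - 2 * ρ)) :=
    fun L hL => integral_ball_normSq_le_of_budget hV hA hL
  -- the radial density `S₀` and the integrand `g`
  set S₀ : ℝ → ℝ := fun t => ∫ θ : sphere (0 : EuclideanSpace ℝ (Fin 3)) 1,
      (⟪V (t • (θ : EuclideanSpace ℝ (Fin 3))), (θ : EuclideanSpace ℝ (Fin 3))⟫ ^ 2 + P (t • (θ : EuclideanSpace ℝ (Fin 3))))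
        ∂(volume : Measure (EuclideanSpace ℝ (Fin 3))).toSphere with hS₀
  set g : EuclideanSpace ℝ (Fin 3) → ℝ := fun y => (3 * ⟪V y, y⟫ ^ 2 / ‖y‖ ^ 2 - ‖V y‖ ^ 2) / ‖y‖ ^ 3 with hg
  -- Step 1: `S = r² S₀(r)`
  have hder := hasDerivAt_integral_ball_normalSq_add hV hP (0 : EuclideanSpace ℝ (Fin 3)) hr
  simp only [sub_zero, add_zero] at hder
  have e1 : S = r ^ 2 * S₀ r := hS.unique hder
  -- Step 2: the shell law at `α = 3` about the origin
  have hshell : ∀ R : ℝ, r < R → S₀ r - S₀ R = ∫ y in ball (0 : EuclideanSpace ℝ (Fin 3)) R \ ball 0 r, g y := by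
    intro R hrR
    have hR : 0 < R := hr.trans hrR
    have h := shellLaw γ 3 hprof (0 : EuclideanSpace ℝ (Fin 3)) hr hrR
    have h3 : (3 : ℝ) - 3 = 0 := by norm_num
    rw [h3, Real.rpow_zero, Real.rpow_zero, one_mul, one_mul] at h
    have hs₁ := sphereIntegral_normalSq_eq (V := V) (P := P) (0 : EuclideanSpace ℝ (Fin 3)) hr
    have hs₂ := sphereIntegral_normalSq_eq (V := V) (P := P) (0 : EuclideanSpace ℝ (Fin 3)) hR
    simp only [add_zero, sub_zero] at h hs₁ hs₂
    rw [hs₁, hs₂] at h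
    have hint : ∫ y in ball (0 : EuclideanSpace ℝ (Fin 3)) R \ ball 0 r, ‖y‖ ^ (-(3 : ℝ)) *
          (‖V y‖ ^ 2 - 3 * (⟪V y, y⟫ ^ 2 / ‖y‖ ^ 2) + 0 * P y)
        = -∫ y in ball (0 : EuclideanSpace ℝ (Fin 3)) R \ ball 0 r, g y := by
      rw [← integral_neg]
      refine integral_congr_ae (ae_of_all _ fun y => ?_)
      simp only [hg]
      have hp : ‖y‖ ^ (-(3 : ℝ)) = (‖y‖ ^ 3)⁻¹ := by
        rw [Real.rpow_neg (norm_nonneg _), show (3 : ℝ) = ((3 : ℕ) : ℝ) by norm_num, Real.rpow_natCast]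
      rw [hp]
      ring
    rw [hint] at h
    simp only [hS₀]
    linarith
  -- Step 3: `g` is integrable on the exterior of `B_r`
  have hgI : IntegrableOn g (ball (0 : EuclideanSpace ℝ (Fin 3)) r)ᶜ :=
    integrableOn_twoSphereIntegrand_compl_ball hV (by linarith) hr hE
  -- Step 4: cheap spheres `t_k ∈ [2^k R₀, 2^{k+1} R₀]`, `R₀ = r + 1`
  set R₀ : ℝ := r + 1 with hR₀
  have hR₀pos : 0 < R₀ := by positivity
  have hLk : ∀ k : ℕ, 0 < (2 : ℝ) ^ k * R₀ := fun k => by positivity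
  choose t ht hle using fun k : ℕ => exists_radius_sphere_le_shell (U := V) (Q := P) hV hP (hLk k)
  have htr : ∀ k, r < t k := fun k => by
    have h1 : (2 : ℝ) ^ k * R₀ ≥ R₀ := le_mul_of_one_le_left hR₀pos.le (one_le_pow₀ (by norm_num))
    have h2 := (ht k).1
    linarith
  have htpos : ∀ k, 0 < t k := fun k => hr.trans (htr k)
  -- |S₀(t_k)| ≤ (2^k R₀)⁻³ ∫_{shell_k} (‖V‖² + |P|)
  have hSbound : ∀ k, |S₀ (t k)| ≤ ((2 : ℝ) ^ k * R₀)⁻¹ ^ 3 *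
      ∫ y in ball (0 : EuclideanSpace ℝ (Fin 3)) (2 * (2 ^ k * R₀)) \ ball 0 (2 ^ k * R₀), (‖V y‖ ^ 2 + |P y|) := by
    intro k
    have hc0 : Continuous fun θ : sphere (0 : EuclideanSpace ℝ (Fin 3)) 1 => t k • (θ : EuclideanSpace ℝ (Fin 3)) := by fun_prop
    have hf1 : Continuous fun θ : sphere (0 : EuclideanSpace ℝ (Fin 3)) 1 =>
        ⟪V (t k • (θ : EuclideanSpace ℝ (Fin 3))), (θ : EuclideanSpace ℝ (Fin 3))⟫ ^ 2 + P (t k • (θ : EuclideanSpace ℝ (Fin 3))) :=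
      (((hV.comp hc0).inner continuous_subtype_val).pow 2).add (hP.comp hc0)
    have hf2 : Continuous fun θ : sphere (0 : EuclideanSpace ℝ (Fin 3)) 1 =>
        ‖V (t k • (θ : EuclideanSpace ℝ (Fin 3)))‖ ^ 2 + |P (t k • (θ : EuclideanSpace ℝ (Fin 3)))| :=
      ((hV.comp hc0).norm.pow 2).add (continuous_abs.comp (hP.comp hc0))
    have hI1 := integrable_sphere_of_continuous hf1
    have hI2 := integrable_sphere_of_continuous hf2
    have habs : |S₀ (t k)| ≤ ∫ θ : sphere (0 : EuclideanSpace ℝ (Fin 3)) 1,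
        (‖V (t k • (θ : EuclideanSpace ℝ (Fin 3)))‖ ^ 2 + |P (t k • (θ : EuclideanSpace ℝ (Fin 3)))|)
          ∂(volume : Measure (EuclideanSpace ℝ (Fin 3))).toSphere := by
      simp only [hS₀]
      refine (abs_integral_le_integral_abs).trans (integral_mono hI1.abs hI2 fun θ => ?_)
      have hθ : ‖(θ : EuclideanSpace ℝ (Fin 3))‖ = 1 := by simp
      have hcs := abs_real_inner_le_norm (V (t k • (θ : EuclideanSpace ℝ (Fin 3)))) (θ : EuclideanSpace ℝ (Fin 3))
      rw [hθ, mul_one] at hcs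
      have h0 : 0 ≤ |⟪V (t k • (θ : EuclideanSpace ℝ (Fin 3))), (θ : EuclideanSpace ℝ (Fin 3))⟫| := abs_nonneg _
      have hsq : ⟪V (t k • (θ : EuclideanSpace ℝ (Fin 3))), (θ : EuclideanSpace ℝ (Fin 3))⟫ ^ 2
          ≤ ‖V (t k • (θ : EuclideanSpace ℝ (Fin 3)))‖ ^ 2 := by
        nlinarith [sq_abs ⟪V (t k • (θ : EuclideanSpace ℝ (Fin 3))), (θ : EuclideanSpace ℝ (Fin 3))⟫, norm_nonneg (V (t k • (θ : EuclideanSpace ℝ (Fin 3))))]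
      show |⟪V (t k • (θ : EuclideanSpace ℝ (Fin 3))), (θ : EuclideanSpace ℝ (Fin 3))⟫ ^ 2 + P (t k • (θ : EuclideanSpace ℝ (Fin 3)))|
        ≤ ‖V (t k • (θ : EuclideanSpace ℝ (Fin 3)))‖ ^ 2 + |P (t k • (θ : EuclideanSpace ℝ (Fin 3)))|
      calc |⟪V (t k • (θ : EuclideanSpace ℝ (Fin 3))), (θ : EuclideanSpace ℝ (Fin 3))⟫ ^ 2 + P (t k • (θ : EuclideanSpace ℝ (Fin 3)))|
          ≤ |⟪V (t k • (θ : EuclideanSpace ℝ (Fin 3))), (θ : EuclideanSpace ℝ (Fin 3))⟫ ^ 2| + |P (t k • (θ : EuclideanSpace ℝ (Fin 3)))| :=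
            abs_add_le _ _
        _ ≤ ‖V (t k • (θ : EuclideanSpace ℝ (Fin 3)))‖ ^ 2 + |P (t k • (θ : EuclideanSpace ℝ (Fin 3)))| := by
            rw [abs_of_nonneg (sq_nonneg _)]; exact add_le_add hsq le_rfl
    -- divide the selection inequality by `(2^k R₀) t_k²`
    have hL := hLk k
    have ht1 : (2 : ℝ) ^ k * R₀ ≤ t k := (ht k).1
    have hInn : 0 ≤ ∫ θ : sphere (0 : EuclideanSpace ℝ (Fin 3)) 1,
        (‖V (t k • (θ : EuclideanSpace ℝ (Fin 3)))‖ ^ 2 + |P (t k • (θ : EuclideanSpace ℝ (Fin 3)))|)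
          ∂(volume : Measure (EuclideanSpace ℝ (Fin 3))).toSphere := integral_nonneg fun θ => by positivity
    have hsel := hle k
    have hJnn : 0 ≤ ∫ y in ball (0 : EuclideanSpace ℝ (Fin 3)) (2 * (2 ^ k * R₀)) \ ball 0 (2 ^ k * R₀), (‖V y‖ ^ 2 + |P y|) :=
      setIntegral_nonneg (measurableSet_ball.diff measurableSet_ball) fun y _ => by positivity
    have hkey : ((2 : ℝ) ^ k * R₀) ^ 3 * |S₀ (t k)|
        ≤ ∫ y in ball (0 : EuclideanSpace ℝ (Fin 3)) (2 * (2 ^ k * R₀)) \ ball 0 (2 ^ k * R₀), (‖V y‖ ^ 2 + |P y|) := by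
      calc ((2 : ℝ) ^ k * R₀) ^ 3 * |S₀ (t k)|
          ≤ ((2 : ℝ) ^ k * R₀) * (t k) ^ 2 * ∫ θ : sphere (0 : EuclideanSpace ℝ (Fin 3)) 1,
              (‖V (t k • (θ : EuclideanSpace ℝ (Fin 3)))‖ ^ 2 + |P (t k • (θ : EuclideanSpace ℝ (Fin 3)))|)
                ∂(volume : Measure (EuclideanSpace ℝ (Fin 3))).toSphere := by
            have hsq : ((2 : ℝ) ^ k * R₀) ^ 2 ≤ (t k) ^ 2 := pow_le_pow_left₀ hL.le ht1 2
            calc ((2 : ℝ) ^ k * R₀) ^ 3 * |S₀ (t k)| = ((2 : ℝ) ^ k * R₀) * (((2 : ℝ) ^ k * R₀) ^ 2 * |S₀ (t k)|) := by ring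
              _ ≤ ((2 : ℝ) ^ k * R₀) * ((t k) ^ 2 * ∫ θ : sphere (0 : EuclideanSpace ℝ (Fin 3)) 1,
                  (‖V (t k • (θ : EuclideanSpace ℝ (Fin 3)))‖ ^ 2 + |P (t k • (θ : EuclideanSpace ℝ (Fin 3)))|)
                    ∂(volume : Measure (EuclideanSpace ℝ (Fin 3))).toSphere) :=
                  mul_le_mul_of_nonneg_left (mul_le_mul hsq habs (abs_nonneg _) (sq_nonneg _)) hL.le
              _ = _ := by ring
        _ ≤ _ := by rw [mul_assoc]; exact hsel
    rw [inv_pow, ← div_eq_inv_mul, le_div_iff₀ (pow_pos hL 3)]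
    linarith
  -- the shell budget: `∫_{shell_k}(‖V‖² + |P|) ≤ C(1 + (2^{k+1}R₀)^{1−2ρ}) + (2/3)ε D + (1/3)ε⁻²(4π/3)(2^{k+1}R₀)^{7−4ρ}`
  set D : ℝ := ∫ y, |P y| ^ (3 / 2 : ℝ) * ‖y‖ ^ (2 * ρ - 2) with hDdef
  have hDnn : 0 ≤ D := integral_nonneg fun y => mul_nonneg (Real.rpow_nonneg (abs_nonneg _) _) (Real.rpow_nonneg (norm_nonneg _) _)
  have hshellE : ∀ k, ∫ y in ball (0 : EuclideanSpace ℝ (Fin 3)) (2 * (2 ^ k * R₀)) \ ball 0 (2 ^ k * R₀), ‖V y‖ ^ 2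
      ≤ C * (1 + (2 * (2 ^ k * R₀)) ^ (1 - 2 * ρ)) := by
    intro k
    refine le_trans (setIntegral_mono_set (((hV.norm.pow 2).continuousOn.integrableOn_compact (isCompact_closedBall 0 _)).mono_set
      ball_subset_closedBall) (ae_of_all _ fun y => sq_nonneg _) (ae_of_all _ fun y hy => hy.1)) (hE _ (by positivity))
  have hshellP : ∀ k (ε : ℝ), 0 < ε → ∫ y in ball (0 : EuclideanSpace ℝ (Fin 3)) (2 * (2 ^ k * R₀)) \ ball 0 (2 ^ k * R₀), |P y|
      ≤ 2 / 3 * ε * D + 1 / 3 * ε⁻¹ ^ 2 * ((2 * (2 ^ k * R₀)) ^ (4 - 4 * ρ) * (4 * Real.pi * (2 * (2 ^ k * R₀)) ^ 3 / 3)) := by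
    intro k ε hε
    have hL := hLk k
    have hsub : ball (0 : EuclideanSpace ℝ (Fin 3)) (2 * (2 ^ k * R₀)) \ ball 0 (2 ^ k * R₀) ⊆ (ball (0 : EuclideanSpace ℝ (Fin 3)) (2 ^ k * R₀))ᶜ :=
      fun y hy => hy.2
    have hWc : ContinuousOn (fun y : EuclideanSpace ℝ (Fin 3) => ‖y‖ ^ (4 - 4 * ρ)) (closedBall (0 : EuclideanSpace ℝ (Fin 3)) (2 * (2 ^ k * R₀))) :=
      (continuous_norm.continuousOn).rpow_const fun y _ => Or.inr (by linarith)
    have hWI : IntegrableOn (fun y : EuclideanSpace ℝ (Fin 3) => ‖y‖ ^ (4 - 4 * ρ))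
        (ball (0 : EuclideanSpace ℝ (Fin 3)) (2 * (2 ^ k * R₀)) \ ball 0 (2 ^ k * R₀)) :=
      (hWc.integrableOn_compact (isCompact_closedBall _ _)).mono_set fun y hy => ball_subset_closedBall hy.1
    have hQI : IntegrableOn (fun y => |P y|) (ball (0 : EuclideanSpace ℝ (Fin 3)) (2 * (2 ^ k * R₀)) \ ball 0 (2 ^ k * R₀)) :=
      ((continuous_abs.comp hP).continuousOn.integrableOn_compact (isCompact_closedBall (0 : EuclideanSpace ℝ (Fin 3)) _)).mono_set
        fun y hy => ball_subset_closedBall hy.1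
    have hY := setIntegral_abs_le_young (Q := P) hL hε hD (measurableSet_ball.diff measurableSet_ball) hsub hQI hWI
    -- the weight integral over the shell
    have hWle : ∫ y in ball (0 : EuclideanSpace ℝ (Fin 3)) (2 * (2 ^ k * R₀)) \ ball 0 (2 ^ k * R₀), ‖y‖ ^ (4 - 4 * ρ)
        ≤ (2 * (2 ^ k * R₀)) ^ (4 - 4 * ρ) * (4 * Real.pi * (2 * (2 ^ k * R₀)) ^ 3 / 3) := by
      have hc : IntegrableOn (fun _ : EuclideanSpace ℝ (Fin 3) => (2 * (2 ^ k * R₀)) ^ (4 - 4 * ρ))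
          (ball (0 : EuclideanSpace ℝ (Fin 3)) (2 * (2 ^ k * R₀)) \ ball 0 (2 ^ k * R₀)) := by
        refine integrableOn_const ?_
        exact (measure_mono (fun y hy => hy.1)).trans_lt measure_ball_lt_top |>.ne
      have h1 : ∫ y in ball (0 : EuclideanSpace ℝ (Fin 3)) (2 * (2 ^ k * R₀)) \ ball 0 (2 ^ k * R₀), ‖y‖ ^ (4 - 4 * ρ)
          ≤ ∫ y in ball (0 : EuclideanSpace ℝ (Fin 3)) (2 * (2 ^ k * R₀)) \ ball 0 (2 ^ k * R₀), (2 * (2 ^ k * R₀)) ^ (4 - 4 * ρ) := by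
        refine setIntegral_mono_on hWI hc (measurableSet_ball.diff measurableSet_ball) fun y hy => ?_
        have hy1 : ‖y‖ < 2 * (2 ^ k * R₀) := mem_ball_zero_iff.1 hy.1
        exact Real.rpow_le_rpow (norm_nonneg _) hy1.le (by linarith)
      have h2 : ∫ y in ball (0 : EuclideanSpace ℝ (Fin 3)) (2 * (2 ^ k * R₀)) \ ball 0 (2 ^ k * R₀), (2 * (2 ^ k * R₀)) ^ (4 - 4 * ρ)
          ≤ ∫ y in ball (0 : EuclideanSpace ℝ (Fin 3)) (2 * (2 ^ k * R₀)), (2 * (2 ^ k * R₀)) ^ (4 - 4 * ρ) :=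
        setIntegral_mono_set (integrableOn_const measure_ball_lt_top.ne) (ae_of_all _ fun y => Real.rpow_nonneg (by positivity) _)
          (ae_of_all _ fun y hy => hy.1)
      have h3 : ∫ y in ball (0 : EuclideanSpace ℝ (Fin 3)) (2 * (2 ^ k * R₀)), (2 * (2 ^ k * R₀)) ^ (4 - 4 * ρ)
          = (2 * (2 ^ k * R₀)) ^ (4 - 4 * ρ) * (4 * Real.pi * (2 * (2 ^ k * R₀)) ^ 3 / 3) := by
        have h4 := integral_ball_one_eq (0 : EuclideanSpace ℝ (Fin 3)) (δ := 2 * (2 ^ k * R₀)) (by positivity)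
        rw [setIntegral_const, smul_eq_mul] at h4 ⊢
        rw [mul_one] at h4
        rw [h4, mul_comm]
      linarith
    have hε2 : 0 ≤ 1 / 3 * ε⁻¹ ^ 2 := by positivity
    nlinarith [hWle, hY, hε2]
  -- hence `S₀(t_k) → 0`
  have hStend : Tendsto (fun k => S₀ (t k)) atTop (𝓝 0) := by
    -- explicit majorant `b_k`
    have hb : ∀ k, |S₀ (t k)| ≤ C * ((2 : ℝ) ^ k * R₀) ^ (-(3 : ℝ)) + C * 2 ^ (1 - 2 * ρ) * ((2 : ℝ) ^ k * R₀) ^ (-(2 + 2 * ρ))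
        + 2 / 3 * D * ((2 : ℝ) ^ k * R₀) ^ (-((2 + 4 * ρ) / 3))
        + 1 / 3 * (4 * Real.pi * 2 ^ (7 - 4 * ρ) / 3) * ((2 : ℝ) ^ k * R₀) ^ (-((2 + 4 * ρ) / 3)) := by
      intro k
      have hL := hLk k
      set L : ℝ := (2 : ℝ) ^ k * R₀ with hLdef
      have hε : 0 < L ^ ((7 - 4 * ρ) / 3) := Real.rpow_pos_of_pos hL _
      have h1 := hSbound k
      have h2 := hshellE k
      have h3 := hshellP k _ hε
      have hsplit : ∫ y in ball (0 : EuclideanSpace ℝ (Fin 3)) (2 * L) \ ball 0 L, (‖V y‖ ^ 2 + |P y|)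
          = (∫ y in ball (0 : EuclideanSpace ℝ (Fin 3)) (2 * L) \ ball 0 L, ‖V y‖ ^ 2)
            + ∫ y in ball (0 : EuclideanSpace ℝ (Fin 3)) (2 * L) \ ball 0 L, |P y| :=
        integral_add ((((hV.norm.pow 2).continuousOn.integrableOn_compact (isCompact_closedBall (0 : EuclideanSpace ℝ (Fin 3)) _)).mono_set
          fun y hy => ball_subset_closedBall hy.1))
          (((continuous_abs.comp hP).continuousOn.integrableOn_compact (isCompact_closedBall (0 : EuclideanSpace ℝ (Fin 3)) _)).mono_set
            fun y hy => ball_subset_closedBall hy.1)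
      rw [hsplit] at h1
      -- rpow bookkeeping
      have hC : 0 ≤ C := by
        have h := hE 1 one_pos
        rw [Real.one_rpow] at h
        have h0 : 0 ≤ ∫ y in ball (0 : EuclideanSpace ℝ (Fin 3)) 1, ‖V y‖ ^ 2 := setIntegral_nonneg measurableSet_ball fun y _ => sq_nonneg _
        linarith
      have eA : L⁻¹ ^ 3 * (C * (1 + (2 * L) ^ (1 - 2 * ρ))) = C * L ^ (-(3 : ℝ)) + C * 2 ^ (1 - 2 * ρ) * L ^ (-(2 + 2 * ρ)) := by
        rw [Real.mul_rpow (by norm_num) hL.le, inv_pow, ← Real.rpow_natCast L 3, ← Real.rpow_neg hL.le]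
        have e : L ^ (-((3 : ℕ) : ℝ)) * L ^ (1 - 2 * ρ) = L ^ (-(2 + 2 * ρ)) := by
          rw [← Real.rpow_add hL]; norm_num; ring_nf
        push_cast
        linear_combination (C * 2 ^ (1 - 2 * ρ)) * e
      have eP1 : L⁻¹ ^ 3 * (2 / 3 * L ^ ((7 - 4 * ρ) / 3) * D) = 2 / 3 * D * L ^ (-((2 + 4 * ρ) / 3)) := by
        rw [inv_pow, ← Real.rpow_natCast L 3, ← Real.rpow_neg hL.le]
        have e : L ^ (-((3 : ℕ) : ℝ)) * L ^ ((7 - 4 * ρ) / 3) = L ^ (-((2 + 4 * ρ) / 3)) := by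
          rw [← Real.rpow_add hL]; norm_num; ring_nf
        linear_combination (2 / 3 * D) * e
      have eP2 : L⁻¹ ^ 3 * (1 / 3 * (L ^ ((7 - 4 * ρ) / 3))⁻¹ ^ 2 * ((2 * L) ^ (4 - 4 * ρ) * (4 * Real.pi * (2 * L) ^ 3 / 3)))
          = 1 / 3 * (4 * Real.pi * 2 ^ (7 - 4 * ρ) / 3) * L ^ (-((2 + 4 * ρ) / 3)) := by
        rw [Real.mul_rpow (by norm_num) hL.le, inv_pow, inv_pow, ← Real.rpow_natCast L 3, ← Real.rpow_neg hL.le, mul_pow,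
          ← Real.rpow_natCast L 3, ← Real.rpow_natCast (L ^ ((7 - 4 * ρ) / 3)) 2, ← Real.rpow_mul hL.le, ← Real.rpow_neg hL.le,
          ← Real.rpow_natCast (2 : ℝ) 3]
        have e27 : (2 : ℝ) ^ (4 - 4 * ρ) * (2 : ℝ) ^ ((3 : ℕ) : ℝ) = 2 ^ (7 - 4 * ρ) := by
          rw [← Real.rpow_add (by norm_num)]; norm_num; ring_nf
        have e : L ^ (-((3 : ℕ) : ℝ)) * L ^ (-((7 - 4 * ρ) / 3 * ((2 : ℕ) : ℝ))) * (L ^ (4 - 4 * ρ) * L ^ ((3 : ℕ) : ℝ))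
            = L ^ (-((2 + 4 * ρ) / 3)) := by
          rw [← Real.rpow_add hL, ← Real.rpow_add hL, ← Real.rpow_add hL]; norm_num; ring_nf
        push_cast at e e27 ⊢
        linear_combination (1 / 3 * (4 * Real.pi / 3)) * e27 * L ^ (-((2 + 4 * ρ) / 3)) + (1 / 3 * (4 * Real.pi / 3) * (2 : ℝ) ^ (4 - 4 * ρ) * (2 : ℝ) ^ (3 : ℝ)) * e
      have hinv : 0 ≤ L⁻¹ ^ 3 := by positivity
      calc |S₀ (t k)| ≤ L⁻¹ ^ 3 * ((∫ y in ball (0 : EuclideanSpace ℝ (Fin 3)) (2 * L) \ ball 0 L, ‖V y‖ ^ 2)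
            + ∫ y in ball (0 : EuclideanSpace ℝ (Fin 3)) (2 * L) \ ball 0 L, |P y|) := h1
        _ ≤ L⁻¹ ^ 3 * (C * (1 + (2 * L) ^ (1 - 2 * ρ)) + (2 / 3 * L ^ ((7 - 4 * ρ) / 3) * D
            + 1 / 3 * (L ^ ((7 - 4 * ρ) / 3))⁻¹ ^ 2 * ((2 * L) ^ (4 - 4 * ρ) * (4 * Real.pi * (2 * L) ^ 3 / 3)))) :=
            mul_le_mul_of_nonneg_left (add_le_add h2 h3) hinv
        _ = _ := by linear_combination eA + eP1 + eP2
    have hlim : Tendsto (fun k : ℕ => C * ((2 : ℝ) ^ k * R₀) ^ (-(3 : ℝ)) + C * 2 ^ (1 - 2 * ρ) * ((2 : ℝ) ^ k * R₀) ^ (-(2 + 2 * ρ))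
        + 2 / 3 * D * ((2 : ℝ) ^ k * R₀) ^ (-((2 + 4 * ρ) / 3))
        + 1 / 3 * (4 * Real.pi * 2 ^ (7 - 4 * ρ) / 3) * ((2 : ℝ) ^ k * R₀) ^ (-((2 + 4 * ρ) / 3))) atTop (𝓝 0) := by
      have h1 := tendsto_const_mul_dyadic_rpow_neg hR₀pos (by norm_num : (0 : ℝ) < 3) C
      have h2 := tendsto_const_mul_dyadic_rpow_neg hR₀pos (by linarith : (0 : ℝ) < 2 + 2 * ρ) (C * 2 ^ (1 - 2 * ρ))
      have h3 := tendsto_const_mul_dyadic_rpow_neg hR₀pos (by linarith : (0 : ℝ) < (2 + 4 * ρ) / 3) (2 / 3 * D)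
      have h4 := tendsto_const_mul_dyadic_rpow_neg hR₀pos (by linarith : (0 : ℝ) < (2 + 4 * ρ) / 3)
        (1 / 3 * (4 * Real.pi * 2 ^ (7 - 4 * ρ) / 3))
      simpa using ((h1.add h2).add h3).add h4
    exact squeeze_zero_norm (fun k => by rw [Real.norm_eq_abs]; exact hb k) hlim
  -- Step 5: the shell integrals converge to the exterior integral
  set s : ℕ → Set (EuclideanSpace ℝ (Fin 3)) := fun k => ball 0 (t k) \ ball 0 r with hs
  have hmono : Monotone s := by
    refine monotone_nat_of_le_succ fun k => ?_
    have h1 : t k ≤ t (k + 1) := by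
      have a := (ht k).2
      have b := (ht (k + 1)).1
      rw [pow_succ] at b
      linarith
    exact fun y hy => ⟨ball_subset_ball h1 hy.1, hy.2⟩
  have hUnion : (⋃ k, s k) = (ball (0 : EuclideanSpace ℝ (Fin 3)) r)ᶜ := by
    ext y
    simp only [mem_iUnion, hs, Set.mem_sdiff, mem_compl_iff, mem_ball_zero_iff, not_lt]
    constructor
    · rintro ⟨k, -, hk⟩; exact hk
    · intro hy
      obtain ⟨k, hk⟩ := pow_unbounded_of_one_lt (‖y‖ / R₀) (by norm_num : (1 : ℝ) < 2)
      refine ⟨k, ?_, hy⟩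
      rw [div_lt_iff₀ hR₀pos] at hk
      exact hk.trans_le (ht k).1
  have htend := tendsto_setIntegral_of_monotone (f := g) (μ := volume)
    (fun k => (measurableSet_ball.diff measurableSet_ball : MeasurableSet (s k))) hmono (by rw [hUnion]; exact hgI)
  rw [hUnion] at htend
  -- `S₀ r = ∫_{s_k} g + S₀(t_k)` for every `k`, so `S₀ r = ∫_{(B_r)ᶜ} g`
  have hconst : Tendsto (fun k => (∫ y in s k, g y) + S₀ (t k)) atTop (𝓝 (S₀ r)) := by
    have : (fun k => (∫ y in s k, g y) + S₀ (t k)) = fun _ => S₀ r := by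
      funext k
      have h := hshell (t k) (htr k)
      simp only [hs]
      linarith
    rw [this]
    exact tendsto_const_nhds
  have hlim2 : Tendsto (fun k => (∫ y in s k, g y) + S₀ (t k)) atTop
      (𝓝 ((∫ y in (ball (0 : EuclideanSpace ℝ (Fin 3)) r)ᶜ, g y) + 0)) := htend.add hStend
  have heq := tendsto_nhds_unique hconst hlim2
  rw [add_zero] at heq
  -- assemble
  rw [e1, heq]
  have hπ : Real.pi ≠ 0 := Real.pi_ne_zero
  field_simp

end ClassicalProfile

end Summit.NavierStokesRegularity.NavierStokesRegularity.Theorems.PowerGaugeEulerLiouville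

end
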